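import Mathlib
import Summits.ResolutionOfSingularities.ResolutionOfSingularities.Theorems.RadicialJungCleanModelsModelOfOpenImmersion
import Literature.AlgebraicGeometry.Resolution.ProjectiveModels
import HarnessLib

/-!
# Route `RadicialJung`, crux `CleanModels` (stmt-ResolutionOfSingularities-15917), line `Sketch` rev 15, stub 4c
# `stub_cleanGlobalization3`: valuations centred over the open `X' ⊆ X̄` contain the affine charts of the target `W`

For the projective model `X̄ ⊇ X'` of `K(X')` (`ProjModel.ofOpenImmersion`) and a dominant morphism `π₁ : X' → W` of integral
schemes, a valuation ring `𝒪_w` of `K(X')/k` whose centre on `X̄` lies in `X'`, say at `x'`, CONTAINS (the pull-back along `π₁`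
of) every affine chart `Γ(W, U)` with `π₁ x' ∈ U` (`exists_point_forall_chart_le`): the lift `Spec 𝒪_w → X̄` of the centre
factors through the open `X'` (a local scheme maps into any open containing the image of its closed point), then through the
affine `U`, giving a ring map `Γ(W, U) → 𝒪_w` whose composite with `𝒪_w ⊆ K(X')` is `π₁^♯ ∘ (Γ(W,U) → K(W))` because both
induce `Spec K(X') → X' → W` (`Spec` is faithful; `Spec Γ(W,U) → W` is a monomorphism).  PROVED; bookkeeping for the clean
globalization (the valuations centred over `X'` are «centred on `W`»); nothing here proves resolution in characteristic `p`.
-/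

noncomputable section

set_option linter.dupNamespace false -- mandated namespace of this single-conjunct summit

open CategoryTheory AlgebraicGeometry IsLocalRing
open Literature.AlgebraicGeometry.Resolution Literature.AlgebraicGeometry.Motives

namespace Summit.ResolutionOfSingularities.ResolutionOfSingularities.Theorems.RadicialJung.CleanModels

section CentreCharts

variable {k : Type} [Field k] {X' Xbar W : Scheme.{0}} [IsIntegral X'] [IsIntegral Xbar] [IsIntegral W]
  (j : X' ⟶ Xbar) (πXbar : Xbar ⟶ Spec (.of k))
  (hproj : Literature.AlgebraicGeometry.Motives.IsProjectiveOver (Over.mk πXbar)) [IsOpenImmersion j] [IsDominant j]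
  [Algebra k X'.functionField]
  (halg : Spec.map (CommRingCat.ofHom (algebraMap k X'.functionField)) = X'.fromSpecStalk (genericPoint X') ≫ j ≫ πXbar)
  (π₁ : X' ⟶ W) [IsDominant π₁]

omit [IsIntegral X'] [IsIntegral Xbar] [IsIntegral W] [IsOpenImmersion j] [IsDominant j] [Algebra k X'.functionField]
  [IsDominant π₁] in
/-- A morphism from the spectrum of a local ring lands in every open containing the image of the closed point. [folklore] -/
theorem range_subset_of_closedPoint_mem {O : Type} [CommRing O] [IsLocalRing O] {Y : Scheme.{0}}
    (l : Spec (.of O) ⟶ Y) {U : Set Y} (hU : IsOpen U) (h : l (closedPoint O) ∈ U) : Set.range l ⊆ U := by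
  rintro _ ⟨t, rfl⟩
  exact ((IsLocalRing.specializes_closedPoint t).map l.continuous).mem_open hU h

/-- **Valuations centred over `X'` contain the charts of `W`.**  If the centre of `𝒪_w` on `X̄ ⊇ X'` lies in `X'`, then it is
`j x'` for a point `x'` such that for every affine open `U ∋ π₁ x'` of `W` and every section `a ∈ Γ(W, U)`, the rational
function `π₁^♯(a) ∈ K(X')` lies in `𝒪_w`. [cite: ZariskiSamuel1960, Ch. VI §17] -/
theorem exists_point_forall_chart_le (w : ZariskiRiemannSpace k X'.functionField)
    (hw : (ProjModel.ofOpenImmersion j πXbar hproj halg).centre w ∈ j.opensRange) :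
    ∃ x' : X', j x' = (ProjModel.ofOpenImmersion j πXbar hproj halg).centre w ∧
      ∀ (U : W.Opens) (_ : IsAffineOpen U) (hx : π₁ x' ∈ U) (a : Γ(W, U)),
        haveI : Nonempty U := ⟨⟨_, hx⟩⟩
        RatFn.functionFieldMap π₁ (W.germToFunctionField U a) ∈ w.asValuationSubring := by
  -- the lift `l : Spec 𝒪_w → X̄` of the centre
  obtain ⟨l₀, hl₁, -, hl₃⟩ := (ProjModel.ofOpenImmersion j πXbar hproj halg).isCentre_centre w
  let l : Spec (.of w.asValuationSubring) ⟶ Xbar := l₀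
  have hl₁' : KModel.specKTo w ≫ l = X'.fromSpecStalk (genericPoint X') ≫ j := hl₁
  have hl₃' : l (closedPoint w.asValuationSubring) = (ProjModel.ofOpenImmersion j πXbar hproj halg).centre w := hl₃
  -- it factors through the open `X'`
  have hrange : Set.range l ⊆ Set.range j := by
    refine range_subset_of_closedPoint_mem l j.isOpenEmbedding.isOpen_range ?_
    rw [hl₃']; exact hw
  let l' : Spec (.of w.asValuationSubring) ⟶ X' := IsOpenImmersion.lift j l hrange
  have hl' : l' ≫ j = l := IsOpenImmersion.lift_fac j l hrange
  have hgen' : KModel.specKTo w ≫ l' = X'.fromSpecStalk (genericPoint X') := by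
    rw [← cancel_mono j, Category.assoc, hl', hl₁']
  refine ⟨l' (closedPoint w.asValuationSubring), ?_, fun U hU hx a => ?_⟩
  · rw [← hl₃', ← hl']; rfl
  · haveI : Nonempty U := ⟨⟨_, hx⟩⟩
    -- `m = l' ≫ π₁ : Spec 𝒪_w → W` factors through the affine `U`
    let m : Spec (.of w.asValuationSubring) ⟶ W := l' ≫ π₁
    have hmrange : Set.range m ⊆ Set.range U.ι := by
      rw [Scheme.Opens.range_ι]
      exact range_subset_of_closedPoint_mem m U.2 (by rw [Scheme.Hom.comp_apply]; exact hx)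
    let m' : Spec (.of w.asValuationSubring) ⟶ U := IsOpenImmersion.lift U.ι m hmrange
    have hm' : m' ≫ U.ι = m := IsOpenImmersion.lift_fac U.ι m hmrange
    -- the ring map `φ : Γ(W, U) → 𝒪_w`
    let φ : Γ(W, U) ⟶ CommRingCat.of w.asValuationSubring := Spec.preimage (m' ≫ hU.isoSpec.hom)
    have hφ : Spec.map φ = m' ≫ hU.isoSpec.hom := Spec.map_preimage _
    -- both `𝒪_w ⊆ K ∘ φ` and `π₁^♯ ∘ germ` induce `Spec K(X') → X' → W`
    have key : φ ≫ CommRingCat.ofHom (algebraMap w.asValuationSubring X'.functionField) =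
        W.germToFunctionField U ≫ CommRingCat.ofHom (RatFn.functionFieldMap π₁) := by
      apply Spec.map_injective
      rw [← cancel_mono hU.fromSpec, Spec.map_comp, Spec.map_comp, Category.assoc, Category.assoc, hφ,
        Category.assoc, IsAffineOpen.isoSpec_hom_fromSpec, hm']
      change KModel.specKTo w ≫ l' ≫ π₁ = _
      rw [← Category.assoc, hgen', ← specMap_functionFieldMap_fromSpecStalk π₁]
      congr 1
      -- `Spec (germ) ≫ fromSpec = fromSpecStalk (genericPoint)`
      exact (hU.fromSpecStalk_eq_fromSpecStalk
        (((genericPoint_spec W).mem_open_set_iff U.isOpen).mpr ⟨_, Set.mem_univ _, hx⟩)).symm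
    have key' := congrArg (fun f => f.hom a) key
    change algebraMap w.asValuationSubring X'.functionField (φ.hom a) =
      RatFn.functionFieldMap π₁ (W.germToFunctionField U a) at key'
    rw [← key']
    exact (φ.hom a).2

end CentreCharts

end Summit.ResolutionOfSingularities.ResolutionOfSingularities.Theorems.RadicialJung.CleanModels

end
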